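import Literature.NumberTheory.LFunctions.DeBruijnPhiDecreasing
import HarnessLib

/-!
# The theta series of `Φ`, `Φ′`, `Φ″`: heads and tails in the frequencies `y_n = π(n+1)²e^{4u}`

Topic `Literature/NumberTheory/LFunctions`; a toolbox companion of `DeBruijnPhiSecondDeriv.lean` (one-series forms
`Φ′(u) = −eᵘ∑ P₁(y_n)e^{−y_n}`, `Φ″(u) = eᵘ∑ P₂(y_n)e^{−y_n}` through `phiPolyTerm`, `thetaFreq`) and
`DeBruijnPhiDecreasing.lean` (Wintner: `Φ′ < 0`), written for `DeBruijnPhiLogConcave.lean` (Coffey–Csordas 2013,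
Theorem 2.4: `Φ` is strictly log-concave). For the tree's Rodgers–Tao-normalised Pólya–de Bruijn kernel
`Φ = deBruijnPhi` — term for term the "Jacobi theta function" `Φ(t) = ∑ a_n(t)` of Coffey–Csordas, Math. Comp. 82
(2013), (1.2), and of Csordas–Norfolk–Varga, Trans. AMS 296 (1986), (1.14) — everything below is PROVED:

* `deBruijnPhi_eq_tsum`: `Φ(u) = eᵘ ∑_n P₀(y_n)e^{−y_n}`, `P₀(y) = 2y² − 3y` (Coffey–Csordas (2.9): `q(y) = y(2y − 3)`;
  with `P₁(y) = 8y³ − 30y² + 15y = q₁`, `P₂(y) = 32y⁴ − 224y³ + 330y² − 75y = q₂` of (2.10)–(2.11) already in the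
  toolbox); `deBruijnPhiDeriv₂_neg_arg`: `Φ″` is even;
* HEADS (`n = 0`, `y = y_0 = πx`, `x = e^{4u} ≥ 1`): the exact discriminant
  `P₁(y)²e^{−2y} − P₀(y)P₂(y)e^{−2y} = 16y³(4y² − 12y + 15)e^{−2y}` (`phiPolyTerm_head_discr` = Coffey–Csordas Lemma 2.2,
  (2.8), exactly) with `4y² − 12y + 15 ≥ 16` for `y ≥ π`, and `0 ≤ P₀(y)e^{−y} ≤ 2y²e^{−y}`, `|P₁(y)e^{−y}| ≤ 8y³e^{−y}`,
  `|P₂(y)e^{−y}| ≤ 32y⁴e^{−y}`;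
* TAILS (`n ≥ 1`, where `y_n = (n+1)²y ≥ 4π` and all three weights are positive): the generic term
  `y_{n+1}^d e^{−y_{n+1}} ≤ y^d e^{−4y}·4^d·(1/1000)ⁿ` (`d ≤ 4`; from `(n+2)² ≤ 4·4ⁿ`, `e^{−((n+2)²−4)y} ≤ e^{−4πn}` and
  `4^d e^{−4π} ≤ 256/23⁴ < 1/1000`), whence `∑_{n≥0} y_{n+1}^d e^{−y_{n+1}} ≤ (1000/999)4^d·y^d e^{−4y}` and
  `0 ≤ T₀ ≤ 2·(1000/999)·4²·y²e^{−4y}`, `0 ≤ T₁ ≤ 8·(1000/999)·4³·y³e^{−4y}`, `0 ≤ T₂ ≤ 32·(1000/999)·4⁴·y⁴e^{−4y}` for the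
  tails `T_i = ∑_{n≥0} P_i(y_{n+1})e^{−y_{n+1}}` (cf. Coffey–Csordas Prop 2.1 (i)–(iii): `Φ₁ ≤ 64eᵗy²e^{−4y}`,
  `|Φ₁′| ≤ 565eᵗy³e^{−4y}`, `|Φ₁″| ≤ 1.031·2¹³eᵗy⁴e^{−4y}` — this file's constants are slightly sharper and proved);

## References

* M. W. Coffey, G. Csordas, *On the log-concavity of a Jacobi theta function*, Math. Comp. 82 (2013) 2265–2272,
  (1.2), (2.1)–(2.11), Proposition 2.1, Lemma 2.2. [CoffeyCsordas2013]
* G. Csordas, T. S. Norfolk, R. S. Varga, *The Riemann hypothesis and the Turán inequalities*, Trans. AMS 296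
  (1986), Theorem A, (1.14), Lemma 3.3. [CsordasNorfolkVarga1986]
-/

noncomputable section

open Filter Set
open scoped Real Topology

namespace Literature.NumberTheory.LFunctions

/-! ## 1. `Φ` as one series in the frequencies `y_n` -/

/-- **`Φ` as one series**: `Φ(u) = eᵘ ∑_n y_n (2y_n − 3) e^{−y_n}`, `y_n = π(n+1)²e^{4u}`
(Coffey–Csordas (2.9): `a₁ = eᵗe^{−y}q(y)`, `q(y) = y(2y − 3)`). [cite: CoffeyCsordas2013, (1.2) and (2.9)] -/
theorem deBruijnPhi_eq_tsum (u : ℝ) :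
    deBruijnPhi u = rexp u * ∑' n, phiPolyTerm (-3) 2 0 0 (rexp (4 * u)) n := by
  rw [tsum_phiPolyTerm _ _ _ _ (Real.exp_pos _), deBruijnPhi_eq_expThetaMoment, expThetaMoment_two_mul,
    expThetaMoment_two_mul]
  ring

/-! ## 2. Parity: `Φ″` is even -/

/-- `Φ″` is even: `deBruijnPhiDeriv₂ (−u) = deBruijnPhiDeriv₂ u` (from the oddness of `Φ′`,
`deBruijnPhiDeriv_neg`, and uniqueness of derivatives). [cite: CsordasNorfolkVarga1986, Theorem A (iii)] -/
theorem deBruijnPhiDeriv₂_neg_arg (u : ℝ) : deBruijnPhiDeriv₂ (-u) = deBruijnPhiDeriv₂ u := by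
  have hfun : (fun x => deBruijnPhiDeriv (-x)) = fun x => -deBruijnPhiDeriv x :=
    funext fun x => deBruijnPhiDeriv_neg x
  have h2 : HasDerivAt (fun x => deBruijnPhiDeriv (-x)) (deBruijnPhiDeriv₂ (-u) * -1) u :=
    (hasDerivAt_deBruijnPhiDeriv (-u)).comp u (hasDerivAt_neg u)
  have h3 : HasDerivAt (fun x => deBruijnPhiDeriv (-x)) (-deBruijnPhiDeriv₂ u) u := by
    rw [hfun]; exact (hasDerivAt_deBruijnPhiDeriv u).neg
  have := h2.unique h3
  linarith

/-! ## 3. The head: the exact `n = 0` discriminant (Coffey–Csordas Lemma 2.2) and head bounds -/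

/-- The `n = 0` frequency is `y_0 = πx`. [folklore] -/
private theorem thetaFreq_zero (x : ℝ) : thetaFreq x 0 = π * x := by
  simp [thetaFreq]

/-- **Coffey–Csordas Lemma 2.2, exactly**: with `y = πx`,
`P₁(y)²e^{−2y} − P₀(y)P₂(y)e^{−2y} = 16y³(4y² − 12y + 15)e^{−2y}` ((2.8): `L(t) = 16e^{2t}e^{−2y}y³(15 − 12y + 4y²)`).
[cite: CoffeyCsordas2013, Lemma 2.2 (2.8)] -/
theorem phiPolyTerm_head_discr (x : ℝ) :
    phiPolyTerm 15 (-30) 8 0 x 0 ^ 2 - phiPolyTerm (-3) 2 0 0 x 0 * phiPolyTerm (-75) 330 (-224) 32 x 0 =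
      16 * (π * x) ^ 3 * (4 * (π * x) ^ 2 - 12 * (π * x) + 15) * rexp (-(π * x)) ^ 2 := by
  simp only [phiPolyTerm, thetaFreq_zero]
  ring

/-- `4y² − 12y + 15 = (2y − 3)² + 6 ≥ 16` for `y ≥ π`. [cite: CoffeyCsordas2013, proof of Lemma 2.2] -/
theorem coffeyCsordas_quadratic_ge {y : ℝ} (hy : π ≤ y) : 16 ≤ 4 * y ^ 2 - 12 * y + 15 := by
  have := Real.pi_gt_d2
  nlinarith

/-- Head bound for `Φ`: `0 ≤ P₀(y)e^{−y} ≤ 2y²e^{−y}` for `y = πx`, `x ≥ 1`. [cite: CoffeyCsordas2013, (2.9)] -/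
theorem phiPolyTerm_zero_P0_bounds {x : ℝ} (hx : 1 ≤ x) :
    0 ≤ phiPolyTerm (-3) 2 0 0 x 0 ∧ phiPolyTerm (-3) 2 0 0 x 0 ≤ 2 * (π * x) ^ 2 * rexp (-(π * x)) := by
  have hπ := Real.pi_gt_d2
  have hy : 3.14 ≤ π * x := by nlinarith
  have hy0 : 0 ≤ π * x := by linarith
  have he := (Real.exp_pos (-(π * x))).le
  simp only [phiPolyTerm, thetaFreq_zero]
  constructor
  · exact mul_nonneg (by nlinarith [mul_nonneg hy0 (by linarith : (0:ℝ) ≤ π * x - 3.14)]) he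
  · have : -3 * (π * x) + 2 * (π * x) ^ 2 + 0 * (π * x) ^ 3 + 0 * (π * x) ^ 4 ≤ 2 * (π * x) ^ 2 := by
      nlinarith
    exact mul_le_mul_of_nonneg_right this he

/-- Head bound for `Φ′`: `|P₁(y)e^{−y}| ≤ 8y³e^{−y}` (`|8y³ − 30y² + 15y| ≤ 8y³` for `y ≥ 1/2`). [cite: CoffeyCsordas2013, (2.10)] -/
theorem abs_phiPolyTerm_zero_P1_le {x : ℝ} (hx : 1 ≤ x) :
    |phiPolyTerm 15 (-30) 8 0 x 0| ≤ 8 * (π * x) ^ 3 * rexp (-(π * x)) := by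
  have hπ := Real.pi_gt_d2
  have hy : 3.14 ≤ π * x := by nlinarith
  have hy0 : 0 ≤ π * x := by linarith
  have he := (Real.exp_pos (-(π * x))).le
  simp only [phiPolyTerm, thetaFreq_zero]
  rw [abs_mul, abs_of_nonneg he]
  refine mul_le_mul_of_nonneg_right (abs_le.2 ⟨?_, ?_⟩) he
  · -- `16y³ − 30y² + 15y = y(16y² − 30y + 15) ≥ 0`
    have h1 : 0 ≤ 16 * (π * x) ^ 2 - 30 * (π * x) + 15 := by nlinarith [sq_nonneg (π * x - 1)]
    nlinarith [mul_nonneg hy0 h1]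
  · nlinarith [mul_nonneg hy0 hy0]

/-- Head bound for `Φ″`: `|P₂(y)e^{−y}| ≤ 32y⁴e^{−y}` for `y ≥ π`. [cite: CoffeyCsordas2013, (2.11)] -/
theorem abs_phiPolyTerm_zero_P2_le {x : ℝ} (hx : 1 ≤ x) :
    |phiPolyTerm (-75) 330 (-224) 32 x 0| ≤ 32 * (π * x) ^ 4 * rexp (-(π * x)) := by
  have hπ := Real.pi_gt_d2
  have hy : 3.14 ≤ π * x := by nlinarith
  have hy0 : 0 ≤ π * x := by linarith
  have he := (Real.exp_pos (-(π * x))).le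
  simp only [phiPolyTerm, thetaFreq_zero]
  rw [abs_mul, abs_of_nonneg he]
  refine mul_le_mul_of_nonneg_right (abs_le.2 ⟨?_, ?_⟩) he
  · -- `64y⁴ − 224y³ + 330y² − 75y = 64y²(y − 7/4)² + 134y² − 75y ≥ 0` for `y ≥ 3.14`
    have h1 : 0 ≤ (π * x) ^ 2 * (π * x - 7 / 4) ^ 2 := by positivity
    have h2 : 0 ≤ 134 * (π * x) ^ 2 - 75 * (π * x) := by nlinarith
    nlinarith
  · -- `−224y³ + 330y² − 75y = −y(224y² − 330y + 75) ≤ 0` for `y ≥ 3.14`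
    have h1 : 0 ≤ 224 * (π * x) ^ 2 - 330 * (π * x) + 75 := by nlinarith
    nlinarith [mul_nonneg hy0 h1]

/-! ## 4. The tails: every term of index `n + 1` has `y_{n+1} ≥ 4π` and is dominated geometrically -/

/-- `e^{−4π} < 1/279841 = 1/23⁴`. [folklore] -/
private theorem exp_neg_four_pi_lt : rexp (-(4 * π)) < 1 / 279841 := by
  have h : rexp (-(4 * π)) = rexp (-π) ^ 4 := by
    rw [← Real.exp_nat_mul]; congr 1; push_cast; ring
  rw [h]
  have h0 := (Real.exp_pos (-π)).le
  calc rexp (-π) ^ 4 < (1 / 23) ^ 4 := by gcongr; exact wintner_exp_neg_pi_lt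
    _ = 1 / 279841 := by norm_num

/-- The frequency of index `n + 1` in closed form: `y_{n+1} = (n+2)²·πx`. [folklore] -/
private theorem thetaFreq_succ_eq (x : ℝ) (n : ℕ) : thetaFreq x (n + 1) = ((n : ℝ) + 2) ^ 2 * (π * x) := by
  simp only [thetaFreq]; push_cast; ring

/-- `y_{n+1} ≥ 4π` for `x ≥ 1`. [folklore] -/
private theorem four_pi_le_thetaFreq_succ {x : ℝ} (hx : 1 ≤ x) (n : ℕ) : 4 * π ≤ thetaFreq x (n + 1) :=
  le_trans (by nlinarith [Real.pi_pos]) (four_pi_mul_le_thetaFreq_succ (zero_le_one.trans hx) n)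

/-- `(n + 2)² ≤ 4·4ⁿ`. [folklore] -/
private theorem natCast_add_two_sq_le (n : ℕ) : ((n : ℝ) + 2) ^ 2 ≤ 4 * 4 ^ n := by
  induction n with
  | zero => norm_num
  | succ k ih =>
    push_cast
    have h4 : (4 : ℝ) ^ (k + 1) = 4 ^ k * 4 := pow_succ 4 k
    have hk : (0 : ℝ) ≤ k := k.cast_nonneg
    have h1 : ((k : ℝ) + 1 + 2) ^ 2 ≤ 4 * ((k : ℝ) + 2) ^ 2 := by nlinarith
    rw [h4]
    nlinarith [ih, h1]

/-- **The generic tail term**: for `x ≥ 1`, `y = πx` and `d ≤ 4`,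
`y_{n+1}^d e^{−y_{n+1}} ≤ y^d e^{−4y} · 4^d · (1/1000)ⁿ`
(`y_{n+1} = (n+2)²y`, `(n+2)^{2d} ≤ 4^d·4^{dn}`, `e^{−((n+2)²−4)y} ≤ e^{−4ny} ≤ e^{−4πn}`, `4^d e^{−4π} ≤ 256/23⁴ < 1/1000`). [cite: CoffeyCsordas2013, Proposition 2.1 (proof, (2.5)–(2.6))] -/
theorem thetaFreq_succ_pow_mul_exp_le {x : ℝ} (hx : 1 ≤ x) {d : ℕ} (hd : d ≤ 4) (n : ℕ) :
    thetaFreq x (n + 1) ^ d * rexp (-thetaFreq x (n + 1)) ≤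
      (π * x) ^ d * rexp (-(4 * (π * x))) * 4 ^ d * (1 / 1000) ^ n := by
  have hπ := Real.pi_gt_d2
  set y := π * x with hy
  have hy1 : π ≤ y := by rw [hy]; nlinarith [Real.pi_pos]
  have hy0 : 0 ≤ y := by linarith
  rw [thetaFreq_succ_eq, ← hy]
  -- the power of the frequency
  have hpow : (((n : ℝ) + 2) ^ 2 * y) ^ d ≤ 4 ^ d * (4 ^ d) ^ n * y ^ d := by
    rw [mul_pow]
    have h1 : (((n : ℝ) + 2) ^ 2) ^ d ≤ (4 * 4 ^ n) ^ d := by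
      gcongr; exact natCast_add_two_sq_le n
    calc (((n : ℝ) + 2) ^ 2) ^ d * y ^ d ≤ (4 * 4 ^ n) ^ d * y ^ d := by gcongr
      _ = 4 ^ d * (4 ^ d) ^ n * y ^ d := by rw [mul_pow, ← pow_mul, mul_comm n d, pow_mul]
  -- the exponential: `(n+2)² y = 4y + (n² + 4n) y ≥ 4y + 4n·π`
  have hexp : rexp (-(((n : ℝ) + 2) ^ 2 * y)) ≤ rexp (-(4 * y)) * rexp (-(4 * π)) ^ n := by
    rw [← Real.exp_nat_mul, ← Real.exp_add]
    apply Real.exp_le_exp.2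
    have hn : (0 : ℝ) ≤ n := n.cast_nonneg
    nlinarith [mul_nonneg hn hy0, mul_nonneg (mul_nonneg hn hn) hy0, mul_nonneg hn (sub_nonneg.2 hy1)]
  -- the ratio `4^d e^{−4π} ≤ 1/1000`
  have hratio : (4 : ℝ) ^ d * rexp (-(4 * π)) ≤ 1 / 1000 := by
    have h4 : (4 : ℝ) ^ d ≤ 256 := by
      calc (4 : ℝ) ^ d ≤ 4 ^ 4 := pow_le_pow_right₀ (by norm_num) hd
        _ = 256 := by norm_num
    have := exp_neg_four_pi_lt
    nlinarith [(Real.exp_pos (-(4 * π))).le]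
  have h4d : (0 : ℝ) ≤ 4 ^ d := by positivity
  have hA : (0 : ℝ) ≤ 4 ^ d * (4 ^ d) ^ n * y ^ d := by positivity
  calc (((n : ℝ) + 2) ^ 2 * y) ^ d * rexp (-(((n : ℝ) + 2) ^ 2 * y))
      ≤ (4 ^ d * (4 ^ d) ^ n * y ^ d) * (rexp (-(4 * y)) * rexp (-(4 * π)) ^ n) :=
        mul_le_mul hpow hexp (Real.exp_pos _).le hA
    _ = y ^ d * rexp (-(4 * y)) * 4 ^ d * (4 ^ d * rexp (-(4 * π))) ^ n := by rw [mul_pow]; ring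
    _ ≤ y ^ d * rexp (-(4 * y)) * 4 ^ d * (1 / 1000) ^ n := by
        have h0 : (0 : ℝ) ≤ 4 ^ d * rexp (-(4 * π)) := by positivity
        have h1 : (4 ^ d * rexp (-(4 * π))) ^ n ≤ (1 / 1000 : ℝ) ^ n := pow_le_pow_left₀ h0 hratio n
        exact mul_le_mul_of_nonneg_left h1 (by positivity)

/-- `0 ≤ y_n^j e^{−y_n}` for `x ≥ 0`. [folklore] -/
private theorem thetaFreq_pow_mul_exp_nonneg {x : ℝ} (hx : 0 ≤ x) (j n : ℕ) :
    0 ≤ thetaFreq x n ^ j * rexp (-thetaFreq x n) :=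
  mul_nonneg (pow_nonneg ((mul_nonneg Real.pi_pos.le hx).trans (pi_mul_le_thetaFreq hx n)) j)
    (Real.exp_pos _).le

/-- Summing the generic tail: for `x ≥ 1`, `d ≤ 4`,
`∑_{n ≥ 0} y_{n+1}^d e^{−y_{n+1}} ≤ (1000/999)·4^d · y^d e^{−4y}`. [cite: CoffeyCsordas2013, Proposition 2.1 (proof, (2.5)–(2.6))] -/
theorem tsum_thetaFreq_succ_pow_mul_exp_le {x : ℝ} (hx : 1 ≤ x) {d : ℕ} (hd : d ≤ 4) :
    Summable (fun n => thetaFreq x (n + 1) ^ d * rexp (-thetaFreq x (n + 1))) ∧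
    ∑' n, thetaFreq x (n + 1) ^ d * rexp (-thetaFreq x (n + 1)) ≤
      1000 / 999 * 4 ^ d * ((π * x) ^ d * rexp (-(4 * (π * x)))) := by
  have hx0 : 0 ≤ x := zero_le_one.trans hx
  have hg : Summable fun n : ℕ => (π * x) ^ d * rexp (-(4 * (π * x))) * 4 ^ d * (1 / 1000 : ℝ) ^ n :=
    (summable_geometric_of_lt_one (by norm_num) (by norm_num)).mul_left _
  have hle := thetaFreq_succ_pow_mul_exp_le hx hd
  have hnn : ∀ n, 0 ≤ thetaFreq x (n + 1) ^ d * rexp (-thetaFreq x (n + 1)) := fun n =>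
    thetaFreq_pow_mul_exp_nonneg hx0 d (n + 1)
  have hs : Summable (fun n => thetaFreq x (n + 1) ^ d * rexp (-thetaFreq x (n + 1))) :=
    Summable.of_nonneg_of_le hnn hle hg
  refine ⟨hs, (hs.tsum_le_tsum hle hg).trans (le_of_eq ?_)⟩
  rw [tsum_mul_left, tsum_geometric_of_lt_one (by norm_num) (by norm_num)]
  ring

/-- **The three tails**: for `x ≥ 1` and a weight `(a₁, a₂, a₃, a₄)` whose polynomial
`P(z) = a₁z + a₂z² + a₃z³ + a₄z⁴` satisfies `0 ≤ P(z) ≤ C z^d` for all `z ≥ 4π`,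
`0 ≤ ∑_{n≥0} P(y_{n+1})e^{−y_{n+1}} ≤ C·(1000/999)·4^d·y^d e^{−4y}`. [cite: CoffeyCsordas2013, Proposition 2.1] -/
theorem tsum_phiPolyTerm_succ_bounds {x : ℝ} (hx : 1 ≤ x) (a₁ a₂ a₃ a₄ C : ℝ) {d : ℕ} (hd : d ≤ 4)
    (hP : ∀ z : ℝ, 4 * π ≤ z →
      0 ≤ a₁ * z + a₂ * z ^ 2 + a₃ * z ^ 3 + a₄ * z ^ 4 ∧ a₁ * z + a₂ * z ^ 2 + a₃ * z ^ 3 + a₄ * z ^ 4 ≤ C * z ^ d) :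
    0 ≤ ∑' n, phiPolyTerm a₁ a₂ a₃ a₄ x (n + 1) ∧
    ∑' n, phiPolyTerm a₁ a₂ a₃ a₄ x (n + 1) ≤ C * (1000 / 999 * 4 ^ d * ((π * x) ^ d * rexp (-(4 * (π * x))))) := by
  have hx0 : 0 < x := by linarith
  obtain ⟨hsum, hle⟩ := tsum_thetaFreq_succ_pow_mul_exp_le hx hd
  have hs : Summable fun n => phiPolyTerm a₁ a₂ a₃ a₄ x (n + 1) :=
    (summable_nat_add_iff 1).2 (summable_phiPolyTerm _ _ _ _ hx0)
  have hterm : ∀ n, 0 ≤ phiPolyTerm a₁ a₂ a₃ a₄ x (n + 1) ∧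
      phiPolyTerm a₁ a₂ a₃ a₄ x (n + 1) ≤ C * (thetaFreq x (n + 1) ^ d * rexp (-thetaFreq x (n + 1))) := by
    intro n
    obtain ⟨h0, hC⟩ := hP _ (four_pi_le_thetaFreq_succ hx n)
    have he := (Real.exp_pos (-thetaFreq x (n + 1))).le
    unfold phiPolyTerm
    exact ⟨mul_nonneg h0 he, by rw [← mul_assoc]; exact mul_le_mul_of_nonneg_right hC he⟩
  refine ⟨tsum_nonneg fun n => (hterm n).1, ?_⟩
  calc ∑' n, phiPolyTerm a₁ a₂ a₃ a₄ x (n + 1)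
      ≤ ∑' n, C * (thetaFreq x (n + 1) ^ d * rexp (-thetaFreq x (n + 1))) :=
        hs.tsum_le_tsum (fun n => (hterm n).2) (hsum.mul_left C)
    _ = C * ∑' n, thetaFreq x (n + 1) ^ d * rexp (-thetaFreq x (n + 1)) := tsum_mul_left
    _ ≤ _ := by
        have hC : 0 ≤ C := by
          obtain ⟨h0, hC⟩ := hP (4 * π) le_rfl
          have : (0 : ℝ) < (4 * π) ^ d := by positivity
          nlinarith
        exact mul_le_mul_of_nonneg_left hle hC

/-- Tail of `Φ`: the weight `P₀(z) = 2z² − 3z` has `0 ≤ P₀(z) ≤ 2z²` for `z ≥ 4π`. [cite: CoffeyCsordas2013, Proposition 2.1 (i)] -/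
theorem tsum_phiPolyTerm_P0_succ_bounds {x : ℝ} (hx : 1 ≤ x) :
    0 ≤ ∑' n, phiPolyTerm (-3) 2 0 0 x (n + 1) ∧
    ∑' n, phiPolyTerm (-3) 2 0 0 x (n + 1) ≤ 2 * (1000 / 999 * 4 ^ 2 * ((π * x) ^ 2 * rexp (-(4 * (π * x))))) :=
  tsum_phiPolyTerm_succ_bounds hx _ _ _ _ 2 (by norm_num) fun z hz => by
    have hπ := Real.pi_gt_d2
    have hz12 : 12 ≤ z := by linarith
    constructor <;> nlinarith

/-- Tail of `Φ′`: the weight `P₁(z) = 8z³ − 30z² + 15z` has `0 ≤ P₁(z) ≤ 8z³` for `z ≥ 4π`. [cite: CoffeyCsordas2013, Proposition 2.1 (ii)] -/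
theorem tsum_phiPolyTerm_P1_succ_bounds {x : ℝ} (hx : 1 ≤ x) :
    0 ≤ ∑' n, phiPolyTerm 15 (-30) 8 0 x (n + 1) ∧
    ∑' n, phiPolyTerm 15 (-30) 8 0 x (n + 1) ≤ 8 * (1000 / 999 * 4 ^ 3 * ((π * x) ^ 3 * rexp (-(4 * (π * x))))) :=
  tsum_phiPolyTerm_succ_bounds hx _ _ _ _ 8 (by norm_num) fun z hz => by
    have hπ := Real.pi_gt_d2
    have hz12 : 12 ≤ z := by linarith
    have hz0 : 0 ≤ z := by linarith
    have h1 : 0 ≤ 8 * z ^ 2 - 30 * z + 15 := by nlinarith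
    constructor <;> nlinarith [mul_nonneg hz0 h1, mul_nonneg hz0 hz0]

/-- Tail of `Φ″`: the weight `P₂(z) = 32z⁴ − 224z³ + 330z² − 75z` has `0 ≤ P₂(z) ≤ 32z⁴` for `z ≥ 4π`.
[cite: CoffeyCsordas2013, Proposition 2.1 (iii)] -/
theorem tsum_phiPolyTerm_P2_succ_bounds {x : ℝ} (hx : 1 ≤ x) :
    0 ≤ ∑' n, phiPolyTerm (-75) 330 (-224) 32 x (n + 1) ∧
    ∑' n, phiPolyTerm (-75) 330 (-224) 32 x (n + 1) ≤
      32 * (1000 / 999 * 4 ^ 4 * ((π * x) ^ 4 * rexp (-(4 * (π * x))))) :=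
  tsum_phiPolyTerm_succ_bounds hx _ _ _ _ 32 le_rfl fun z hz => by
    have hπ := Real.pi_gt_d2
    have hz12 : 12 ≤ z := by linarith
    have hz0 : 0 ≤ z := by linarith
    -- `32z³ − 224z² + 330z − 75 = 32z²(z − 7) + 330z − 75 ≥ 0` and `224z² − 330z + 75 ≥ 0` for `z ≥ 12`
    have h1 : 0 ≤ 32 * z ^ 3 - 224 * z ^ 2 + 330 * z - 75 := by
      nlinarith [mul_nonneg (mul_nonneg hz0 hz0) (sub_nonneg.2 (by linarith : (7:ℝ) ≤ z))]
    have h2 : 0 ≤ 224 * z ^ 2 - 330 * z + 75 := by nlinarith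
    constructor <;> nlinarith [mul_nonneg hz0 h1, mul_nonneg hz0 h2]

end Literature.NumberTheory.LFunctions

end
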